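import Summits.PneNP.PneNP.Theorems.ChebyshevTracialDesignLevelMarginals
import HarnessLib

/-!
# Cell pnp-psdrank, route `ChebyshevTracialDesign`: `𝔖ₙ` is transitive on pairs of cuts with given sizes and
# intersection, so joint level counts are class functions of `|U ∩ U'|`

`𝔖ₙ` acts transitively on pairs of vertex sets `(A, B)` with prescribed `|A|`, `|B|`, `|A ∩ B|`
(`exists_perm_image_eq_pair`: glue bijections between the four Venn regions with `Equiv.ofFiberEquiv`). Hence the
JOINT LEVEL COUNTS `#{M : cc(U₁,M) = c₁, cc(U₂,M) = c₂}` depend only on `(|U₁|, |U₂|, |U₁ ∩ U₂|)`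
(`card_filter_cc_cc_eq`, via `cc_perm` of `ChebyshevTracialDesignLevelMarginals`, p425886); in particular the Gram kernel of the
tight relation, `K(U,U') = #{M : cc(U,M) = 1 = cc(U',M)}`, is a class function of `|U ∩ U'|` on the `t`-cuts
(`card_jointTight_eq`) — i.e. `K` lies in the Bose–Mesner algebra of the Johnson scheme `J(n,t)`
[cite: GodsilMeagher2015, §6.1–6.2 (the Johnson scheme: orbitals of 𝔖ₙ on t-sets are the intersection sizes)]. This is the
symmetry input of the `σ₂` brick ("tight-free rectangles have `μν = O(1/n)`", planner p1 N2-SpreadStructure.md (R2); prover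
MEMO-6 Rec. 3): the second eigenvalue of `K` is then read off harmonic test vectors. [cite: Rothvoss2017, §2 (PDF p. 6)]
WHAT THIS IS NOT: no eigenvalue is computed; nothing on psd rank. Supports crux stmt-PneNP-19878.
-/

set_option linter.dupNamespace false -- `Summit.PneNP.PneNP.…`: summit = sub-problem (D-0017)

noncomputable section

namespace Summit.PneNP.PneNP.Theorems.ChebyshevTracialDesignPairTransitive

open Finset Literature.Barriers.PneNP Literature.Combinatorics.Optimization
open Summit.PneNP.PneNP.Theorems.ChebyshevTracialDesignLevelMarginals

variable {n : ℕ}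

/-! ### §1 Transitivity on pairs of vertex sets -/

/-- The four Venn regions of `(A, B)` as fibres of the membership signature `x ↦ (x ∈ A, x ∈ B)`: their sizes are
determined by `|A|`, `|B|`, `|A ∩ B|` (and `n`). -/
theorem card_signature_fibre (A B : Finset (Fin n)) (c : Bool × Bool) :
    (Fintype.card {x : Fin n // (decide (x ∈ A), decide (x ∈ B)) = c} : ℤ) =
      if c = (true, true) then ((A ∩ B).card : ℤ)
      else if c = (true, false) then (A.card : ℤ) - (A ∩ B).card
      else if c = (false, true) then (B.card : ℤ) - (A ∩ B).card
      else (n : ℤ) - A.card - B.card + (A ∩ B).card := by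
  classical
  rw [Fintype.card_subtype]
  obtain ⟨a, b⟩ := c
  have hAB : ((A \ B).card : ℤ) = A.card - (A ∩ B).card := by
    rw [← card_sdiff_add_card_inter A B]; push_cast; ring
  have hBA : ((B \ A).card : ℤ) = B.card - (A ∩ B).card := by
    rw [← card_sdiff_add_card_inter B A, inter_comm]; push_cast; ring
  have hC : (((A ∪ B)ᶜ).card : ℤ) = n - A.card - B.card + (A ∩ B).card := by
    rw [card_compl, Fintype.card_fin]
    have h1 := card_union_add_card_inter A B
    have h2 : (A ∪ B).card ≤ n := by simpa using card_le_univ (A ∪ B)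
    push_cast [Nat.cast_sub h2]
    have : ((A ∪ B).card : ℤ) = A.card + B.card - (A ∩ B).card := by
      have := congrArg (fun m : ℕ => (m : ℤ)) h1; push_cast at this; linarith
    linarith
  cases a <;> cases b
  · -- (false, false): the complement of `A ∪ B`
    simp only [Prod.mk.injEq, Bool.false_eq_true, false_and, and_false, if_false, and_self]
    rw [← hC]; congr 2; ext x; simp
  · -- (false, true): `B \\ A`
    simp only [Prod.mk.injEq, Bool.false_eq_true, false_and, if_false, and_true, if_true]
    rw [← hBA]; congr 2; ext x; simp [mem_sdiff, and_comm]
  · -- (true, false): `A \\ B`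
    simp only [Prod.mk.injEq, Bool.true_eq_false, true_and, if_true]
    rw [← hAB]; congr 2; ext x; simp [mem_sdiff]
  · -- (true, true): `A ∩ B`
    simp only [if_true]
    congr 2; ext x; simp [mem_inter]

/-- **`𝔖ₙ` is transitive on pairs of vertex sets with given sizes and intersection size.** -/
theorem exists_perm_image_eq_pair (A B A' B' : Finset (Fin n)) (hA : A.card = A'.card) (hB : B.card = B'.card)
    (hAB : (A ∩ B).card = (A' ∩ B').card) :
    ∃ π : Equiv.Perm (Fin n), A.image π = A' ∧ B.image π = B' := by
  classical
  let κ : Fin n → Bool × Bool := fun x => (decide (x ∈ A), decide (x ∈ B))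
  let κ' : Fin n → Bool × Bool := fun x => (decide (x ∈ A'), decide (x ∈ B'))
  have hfib : ∀ c : Bool × Bool, Fintype.card {x // κ x = c} = Fintype.card {x // κ' x = c} := by
    intro c
    have h := card_signature_fibre A B c
    have h' := card_signature_fibre A' B' c
    rw [hA, hB, hAB] at h
    exact_mod_cast h.trans h'.symm
  let π : Equiv.Perm (Fin n) := Equiv.ofFiberEquiv (f := κ) (g := κ') fun c => Fintype.equivOfCardEq (hfib c)
  have hπ : ∀ x, κ' (π x) = κ x := fun x => Equiv.ofFiberEquiv_map _ x
  have hmemA : ∀ x, π x ∈ A' ↔ x ∈ A := fun x => by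
    have := congrArg Prod.fst (hπ x)
    simpa [κ, κ'] using this
  have hmemB : ∀ x, π x ∈ B' ↔ x ∈ B := fun x => by
    have := congrArg Prod.snd (hπ x)
    simpa [κ, κ'] using this
  refine ⟨π, ?_, ?_⟩
  · ext y
    constructor
    · intro hy
      obtain ⟨x, hx, rfl⟩ := mem_image.1 hy
      exact (hmemA x).2 hx
    · intro hy
      refine mem_image.2 ⟨π.symm y, (hmemA _).1 (by rw [Equiv.apply_symm_apply]; exact hy), π.apply_symm_apply y⟩
  · ext y
    constructor
    · intro hy
      obtain ⟨x, hx, rfl⟩ := mem_image.1 hy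
      exact (hmemB x).2 hx
    · intro hy
      refine mem_image.2 ⟨π.symm y, (hmemB _).1 (by rw [Equiv.apply_symm_apply]; exact hy), π.apply_symm_apply y⟩

/-! ### §2 Joint level counts are class functions -/

/-- **Joint level counts depend only on the sizes and the intersection**:
`#{M : cc(U₁,M) = c₁, cc(U₂,M) = c₂} = #{M : cc(U₁',M) = c₁, cc(U₂',M) = c₂}` whenever `|U₁| = |U₁'|`, `|U₂| = |U₂'|`,
`|U₁ ∩ U₂| = |U₁' ∩ U₂'|`. -/
theorem card_filter_cc_cc_eq (c₁ c₂ : ℕ) (U₁ U₂ U₁' U₂' : OddSet n) (h₁ : U₁.1.card = U₁'.1.card)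
    (h₂ : U₂.1.card = U₂'.1.card) (h₁₂ : (U₁.1 ∩ U₂.1).card = (U₁'.1 ∩ U₂'.1).card) :
    (univ.filter fun M : PMatch n => cc U₁ M = c₁ ∧ cc U₂ M = c₂).card =
      (univ.filter fun M : PMatch n => cc U₁' M = c₁ ∧ cc U₂' M = c₂).card := by
  obtain ⟨π, hπ₁, hπ₂⟩ := exists_perm_image_eq_pair U₁.1 U₂.1 U₁'.1 U₂'.1 h₁ h₂ h₁₂
  have e₁ : (⟨U₁.1.image π, odd_card_image π U₁⟩ : OddSet n) = U₁' := Subtype.ext hπ₁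
  have e₂ : (⟨U₂.1.image π, odd_card_image π U₂⟩ : OddSet n) = U₂' := Subtype.ext hπ₂
  symm
  refine card_bij' (fun M _ => π⁻¹ • M) (fun M _ => π • M) ?_ ?_ ?_ ?_
  · intro M hM
    simp only [mem_filter, mem_univ, true_and] at hM ⊢
    have k₁ := cc_perm π U₁ (π⁻¹ • M)
    have k₂ := cc_perm π U₂ (π⁻¹ • M)
    rw [smul_inv_smul] at k₁ k₂
    rw [e₁] at k₁
    rw [e₂] at k₂
    exact ⟨by rw [← k₁]; exact hM.1, by rw [← k₂]; exact hM.2⟩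
  · intro M hM
    simp only [mem_filter, mem_univ, true_and] at hM ⊢
    have k₁ := cc_perm π U₁ M
    have k₂ := cc_perm π U₂ M
    rw [e₁] at k₁
    rw [e₂] at k₂
    exact ⟨by rw [k₁]; exact hM.1, by rw [k₂]; exact hM.2⟩
  · intro M _
    exact smul_inv_smul π M
  · intro M _
    exact inv_smul_smul π M

/-- **The Gram kernel of the tight relation is a class function of the intersection size**: for `t`-cuts `U, U'` and
`V, V'` with `|U ∩ U'| = |V ∩ V'|`, `#{M : cc(U,M) = 1 = cc(U',M)} = #{M : cc(V,M) = 1 = cc(V',M)}`. -/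
theorem card_jointTight_eq {t : ℕ} (U U' V V' : OddSet n) (hU : U.1.card = t) (hU' : U'.1.card = t)
    (hV : V.1.card = t) (hV' : V'.1.card = t) (hint : (U.1 ∩ U'.1).card = (V.1 ∩ V'.1).card) :
    (univ.filter fun M : PMatch n => cc U M = 1 ∧ cc U' M = 1).card =
      (univ.filter fun M : PMatch n => cc V M = 1 ∧ cc V' M = 1).card :=
  card_filter_cc_cc_eq 1 1 U U' V V' (hU.trans hV.symm) (hU'.trans hV'.symm) hint

end Summit.PneNP.PneNP.Theorems.ChebyshevTracialDesignPairTransitive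

end
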